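import Literature.MathematicalPhysics.QuantumLattice.HubbardLangerMattisTorus
import HarnessLib

/-!
# Ventures/CertifiedManyBodySolver — Lower/PauliDoublonLevelProj.lean: spectral projections onto a set of levels

HONEST FRAMING: first certified bounds; not a superconductivity verdict; every number certified or labelled float.

Part 2/4 of the Pauli–doublon floor (see `Lower/PauliDoublonFloor.lean`). Pure Mathlib spectral theorem
(`Matrix.IsHermitian.conjStarAlgAut_star_eigenvectorUnitary`): for a Hermitian matrix `A` and a set of eigenvalue
indices `I`, the spectral projection `P_I = U · diag(1_I) · U⋆` satisfies `0 ⪯ P_I ⪯ 1`, `Re Tr P_I = |I|` and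
`Re Tr (A P_I) = Σ_{i∈I} λ_i(A)` — the bridge from a density-matrix floor to a level-sum (Fermi-sum) floor
[cite: LiebLoss1993, §8, proof of Theorem 8.2]. Mathematics and Lean proofs: hubbard-alg L3 seat B (planner-sr-mbsolver-l3-idea-2 g25/g26, `HOME/hubbard-alg/L3-hybrid/tools-seatB/pdbl/NOTE-PDB-L.md` §6, `PauliDoublonSketch.lean` v6 sha16 54e19fa031dc4b1e); tree placement and citations: LIT lane (literature-prover lit-1 g22).
-/

noncomputable section

namespace Summit.Ventures.CertifiedManyBodySolver.Lower

namespace PauliDoublon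

open Literature.MathematicalPhysics.QuantumLattice
open Matrix Finset Filter Literature.Probability.LatticeModels ThermodynamicLimit LangerMattis MeasureTheory
open scoped Topology ComplexOrder

section SpectralProjection

variable {ι : Type*} [Fintype ι] [DecidableEq ι] {A : Matrix ι ι ℂ}

/-- The spectral projection of a Hermitian matrix onto the eigen-levels indexed by `I`. [folklore] -/
noncomputable def levelProj (hA : A.IsHermitian) (I : Finset ι) : Matrix ι ι ℂ :=
  (hA.eigenvectorUnitary : Matrix ι ι ℂ) * diagonal (fun i => if i ∈ I then (1 : ℂ) else 0) *
    star (hA.eigenvectorUnitary : Matrix ι ι ℂ)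

/-- `P_I ⪰ 0`. [folklore] -/
theorem levelProj_posSemidef (hA : A.IsHermitian) (I : Finset ι) :
    (levelProj hA I).PosSemidef := by
  unfold levelProj
  rw [Matrix.star_eq_conjTranspose]
  refine Matrix.PosSemidef.mul_mul_conjTranspose_same ?_ _
  rw [Matrix.posSemidef_diagonal_iff]
  intro i
  split_ifs
  · exact zero_le_one
  · exact le_rfl

/-- `1 − P_I = P_{Iᶜ}` in the eigenbasis. [folklore] -/
theorem one_sub_levelProj (hA : A.IsHermitian) (I : Finset ι) :
    1 - levelProj hA I =
      (hA.eigenvectorUnitary : Matrix ι ι ℂ) * diagonal (fun i => if i ∈ I then (0 : ℂ) else 1) *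
        star (hA.eigenvectorUnitary : Matrix ι ι ℂ) := by
  have hU : (hA.eigenvectorUnitary : Matrix ι ι ℂ) * star (hA.eigenvectorUnitary : Matrix ι ι ℂ) = 1 :=
    Unitary.coe_mul_star_self _
  have hD : diagonal (fun i => if i ∈ I then (0 : ℂ) else 1) =
      1 - diagonal (fun i => if i ∈ I then (1 : ℂ) else 0) := by
    ext i j
    by_cases hij : i = j
    · subst hij
      by_cases hi : i ∈ I <;> simp [hi]
    · simp [hij]
  rw [hD, Matrix.mul_sub, Matrix.sub_mul, Matrix.mul_one, hU, levelProj]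

/-- `1 − P_I ⪰ 0`. [folklore] -/
theorem one_sub_levelProj_posSemidef (hA : A.IsHermitian) (I : Finset ι) :
    (1 - levelProj hA I).PosSemidef := by
  rw [one_sub_levelProj, Matrix.star_eq_conjTranspose]
  refine Matrix.PosSemidef.mul_mul_conjTranspose_same ?_ _
  rw [Matrix.posSemidef_diagonal_iff]
  intro i
  split_ifs
  · exact le_rfl
  · exact zero_le_one

/-- `Re Tr P_I = |I|`. [folklore] -/
theorem re_trace_levelProj (hA : A.IsHermitian) (I : Finset ι) :
    (Matrix.trace (levelProj hA I)).re = I.card := by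
  unfold levelProj
  rw [trace_mul_cycle, Unitary.coe_star_mul_self, Matrix.one_mul, trace_diagonal]
  simp [Finset.sum_ite_mem, Finset.univ_inter]

/-- `Re Tr (A P_I) = Σ_{i∈I} λ_i(A)`. [folklore] -/
theorem re_trace_mul_levelProj (hA : A.IsHermitian) (I : Finset ι) :
    (Matrix.trace (A * levelProj hA I)).re = ∑ i ∈ I, hA.eigenvalues i := by
  have hdiag : star (hA.eigenvectorUnitary : Matrix ι ι ℂ) * A * (hA.eigenvectorUnitary : Matrix ι ι ℂ) =
      diagonal (RCLike.ofReal ∘ hA.eigenvalues) := by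
    have h := hA.conjStarAlgAut_star_eigenvectorUnitary
    rwa [Unitary.conjStarAlgAut_star_apply] at h
  have h1 : A * levelProj hA I =
      A * (hA.eigenvectorUnitary : Matrix ι ι ℂ) * diagonal (fun i => if i ∈ I then (1 : ℂ) else 0) *
        star (hA.eigenvectorUnitary : Matrix ι ι ℂ) := by
    simp only [levelProj, Matrix.mul_assoc]
  rw [h1, trace_mul_comm, ← Matrix.mul_assoc, ← Matrix.mul_assoc, hdiag, diagonal_mul_diagonal,
    trace_diagonal]
  simp [Complex.re_sum, Finset.sum_ite_mem, Finset.univ_inter]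

end SpectralProjection


end PauliDoublon

end Summit.Ventures.CertifiedManyBodySolver.Lower
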